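/-
Copyright (c) 2026 the pub-hodgecm-mathlib formalisation cell (harness21).  Prover seat hodgecm-mathlib-K2E4-p23 (g2), Track B ∕ K2-LIT, h413 =
`stmt-HodgeConjecture-24833`, ENGINE E1, 5Res campaign, (113)∕hmc second half (dealer K2E1-plan (g7) (145) «2b plan =»), part 2b: CONTINUATION AND RESIDUE OF A
WEIGHTED ORBIT-INTEGRAL IDENTITY `∫ w(θ)·Ẽ(z)(orb θ) dθ = C(z)·Ẽ(z)(y₀)` — generic in the space, the family, the orbit and the weight.
-/
import Summits.HodgeConjecture.HodgeConjecture.Theorems.K2E1ContinuedEisensteinResidueFunctionUThree   -- ★ (K2E4-p10) §1 generic: `exists_forall_norm_le_of_isCompact_of_locally_bounded`, `norm_le_of_sphere_bound`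
import Literature.Analysis.Complex.HolomorphicParametricIntegral                              -- ★ `differentiableOn_integral_of_dominated`
import Mathlib.MeasureTheory.Integral.DominatedConvergence
import Mathlib.Analysis.Analytic.Uniqueness
import HarnessLib

/-!
# K2·E1 — `K2E1ContinuedCircleAverageResidue`: CONTINUING A WEIGHTED ORBIT-INTEGRAL IDENTITY OF A HOLOMORPHIC FAMILY TO ITS WHOLE DOMAIN AND TO ITS RESIDUE
# ((113)∕hmc second half, part 2b — the locally-uniform residue currency of ★ `K2E1ContinuedEisensteinResidueFunctionUThree` §1–§2, printed at a general pole `z₀` and a general space)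

Track B ∕ K2-LIT, crux h413 = `stmt-HodgeConjecture-24833`, route of record `HCCMUnconditional`; cell `hodgecm-mathlib`, squad K2, ENGINE E1 (5Res campaign, ARCH-UNITARITY leg).
Prover seat `hodgecm-mathlib-K2E4-p23` (g2).  THEOREMS ONLY (no `def`, no `instance`, no notation, no named-fact hypothesis, no `sorry`); lane `--supports stmt-HodgeConjecture-24833
--as helper` (count-neutral).  CLOSES NO SOCKET.

SETTING (all generic).  `Y` a topological space (E1: `G(𝔸)`), a family `Ec : ℂ → Y → ℂ` on an open `D ⊆ ℂ` with the three EXPORTS-type letters (E1) `hEd : ∀ y, DifferentiableOn (Ec · y) D`,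
(E4) `hEc : ∀ z ∈ D, Continuous (Ec z)`, (E2-bd) `hEbd` = local boundedness on compacts; a continuous ORBIT `orb : ℝ → Y` (E1: `θ ↦ g·k_w(θ)·t_w(a)`), a base point `y₀` (E1: `g`),
a continuous WEIGHT `w : ℝ → ℂ` (E1: `e^{−iqθ}`) and a scalar SYMBOL `C : ℂ → ℂ` holomorphic on `D` (E1: `2π·archTorusCoeff (z + it_w) (p − q) a`, entire by ★ part 2a).
* §1 `exists_forall_norm_sub_mul_le_near` — the compact-uniform bound `‖(z − z₀)Ẽ(z)(y)‖ ≤ M` on `0 < |z − z₀| ≤ ρ∕2`, `y ∈ K` (★ N = 3 §2 at a general pole `z₀`; maximum modulus).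
* §2 **`differentiableOn_orbitIntegral`** — `z ↦ ∫₀^{2π} w(θ)·Ẽ(z)(orb θ) dθ` is holomorphic on `D` (★ `differentiableOn_integral_of_dominated`; the orbit of `[0, 2π]` is compact).
* §3 **`orbitIntegral_eq_of_eventuallyEq`** — if `∫₀^{2π} w·Ẽ(z)∘orb = C(z)·Ẽ(z)(y₀)` near ONE point of a preconnected `D` (E1: near a Godement point, ★ (113)(iii)), then on ALL of `D`.
* §4 **`orbitIntegral_residue_eq`** — at a pole `z₀` (punctured ball in `D`, residue letter `Fp y` analytic at `z₀`, `= (z − z₀)Ẽ(z)(y)` on `𝓝[≠] z₀`, `C` continuous at `z₀`): the RESIDUE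
  `ψ(y) := Fp y z₀` inherits the identity, `∫₀^{2π} w(θ)·ψ(orb θ) dθ = C(z₀)·ψ(y₀)` (dominated convergence along `𝓝[≠] z₀` with the bound of §1).
E1 CONSUMER (part 2c): `Y = U(J₂)(𝔸)`, `Ec` = row 13 ★ `chiEisenstein_meromorphic…`, letters (E1)(E4)(E2-bd) from the (χ,τ)-EXPORTS, §3's germ = ★ (113)(iii) on `1 < Re z`, then §4 ⇒ letter (AV)
of ★ part 1 `inner_rightRegular_eq_of_circleAverage` for the residual form ⇒ `hmc` ⇒ ★ F2b `arch_unitarity_of_rightRegular_matrixCoeff`.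
HONEST LABEL: HC_CM is proved only modulo the 7 printed citations (2 remaining named inputs: hLiu418 = `stmt-HodgeConjecture-24832`, h413 = `stmt-HodgeConjecture-24833`) until rung 0
closes; this file asserts no named fact and closes no socket; count-neutral.

## References
* [MoeglinWaldspurger1995] C. Mœglin, J.-L. Waldspurger, *Spectral decomposition and Eisenstein series* (1995), IV.1.9–IV.1.11 (holomorphy, residues of Eisenstein families).
* [Conway1978] J. B. Conway, *Functions of One Complex Variable* (2nd ed., 1978), IV §3 (identity theorem), VI §1 (maximum modulus).
* [Langlands1976] R. P. Langlands, *On the Functional Equations Satisfied by Eisenstein Series*, LNM 544 (1976), §7.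
-/

set_option autoImplicit false
-- the mandated namespace repeats the single-problem summit's segment (`HodgeConjecture.HodgeConjecture`)
set_option linter.dupNamespace false

noncomputable section

open MeasureTheory intervalIntegral Metric Set Filter
open scoped Real Topology
open Summit.HodgeConjecture.HodgeConjecture.Cruxes.H413.K2E1ContinuedEisensteinResidueFunctionUThree
  (exists_forall_norm_le_of_isCompact_of_locally_bounded norm_le_of_sphere_bound)

namespace Summit.HodgeConjecture.HodgeConjecture.Cruxes.H413.K2E1ContinuedCircleAverageResidue

variable {Y : Type*} [TopologicalSpace Y]

/-! ## §1 The compact-uniform bound near a pole `z₀` -/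

omit [TopologicalSpace Y] in

/-- **THE POLE-FREE EXTENSION** `Φ_y(z) = (z − z₀)Ẽ(z)(y)` (`z ≠ z₀`), `Φ_y(z₀) = Fp y z₀`, is holomorphic on `B(z₀, ρ)` (★ N = 3 `differentiableOn_extension` at a general pole).
[cite: MoeglinWaldspurger1995, IV.1.11] -/
theorem differentiableOn_extension_at (Ec : ℂ → Y → ℂ) {D : Set ℂ} (hDo : IsOpen D) (z₀ : ℂ) {ρ : ℝ}
    (hρD : ∀ z : ℂ, z ≠ z₀ → dist z z₀ < ρ → z ∈ D) (hEd : ∀ y, DifferentiableOn ℂ (fun z => Ec z y) D)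
    (Fp : Y → ℂ → ℂ) (hF : ∀ y, AnalyticAt ℂ (Fp y) z₀) (hFE : ∀ y, Fp y =ᶠ[𝓝[≠] z₀] fun z => (z - z₀) * Ec z y) (y : Y) :
    DifferentiableOn ℂ (fun z : ℂ => if z = z₀ then Fp y z₀ else (z - z₀) * Ec z y) (ball z₀ ρ) := by
  intro z hz
  by_cases h2 : z = z₀
  · subst h2
    have hev : (fun w : ℂ => if w = z then Fp y z else (w - z) * Ec w y) =ᶠ[𝓝 z] Fp y := by
      have h := eventually_nhdsWithin_iff.1 (hFE y)
      filter_upwards [h] with w hw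
      by_cases hw2 : w = z
      · rw [if_pos hw2, hw2]
      · rw [if_neg hw2, hw hw2]
    exact ((hF y).differentiableAt.congr_of_eventuallyEq hev).differentiableWithinAt
  · have hzD : z ∈ D := hρD z h2 (mem_ball.1 hz)
    have hev : (fun w : ℂ => if w = z₀ then Fp y z₀ else (w - z₀) * Ec w y) =ᶠ[𝓝 z] fun w => (w - z₀) * Ec w y := by
      filter_upwards [isOpen_ne.mem_nhds h2] with w hw
      rw [if_neg hw]
    have hd : DifferentiableAt ℂ (fun w => (w - z₀) * Ec w y) z :=
      ((differentiableAt_id.sub (differentiableAt_const _)).mul ((hEd y).differentiableAt (hDo.mem_nhds hzD)))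
    exact (hd.congr_of_eventuallyEq hev).differentiableWithinAt

/-- **THE COMPACT-UNIFORM BOUND NEAR THE POLE** (★ N = 3 `exists_forall_norm_sub_mul_le_near_two` at a general pole `z₀`): for compact `K ⊆ Y` there is `M` with
`‖(z − z₀)Ẽ(z)(y)‖ ≤ M` for `0 < |z − z₀| ≤ ρ∕2`, `y ∈ K`, and `‖Fp y z₀‖ ≤ M`. [cite: MoeglinWaldspurger1995, IV.1.11] [cite: Conway1978, VI §1] -/
theorem exists_forall_norm_sub_mul_le_near (Ec : ℂ → Y → ℂ) {D : Set ℂ} (hDo : IsOpen D) (z₀ : ℂ) {ρ : ℝ} (hρ : 0 < ρ)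
    (hρD : ∀ z : ℂ, z ≠ z₀ → dist z z₀ < ρ → z ∈ D) (hEd : ∀ y, DifferentiableOn ℂ (fun z => Ec z y) D)
    (hEbd : ∀ z₁ ∈ D, ∀ K : Set Y, IsCompact K → ∃ V ∈ 𝓝 z₁, ∃ M : ℝ, ∀ z ∈ V, ∀ y ∈ K, ‖Ec z y‖ ≤ M)
    (Fp : Y → ℂ → ℂ) (hF : ∀ y, AnalyticAt ℂ (Fp y) z₀) (hFE : ∀ y, Fp y =ᶠ[𝓝[≠] z₀] fun z => (z - z₀) * Ec z y)
    {K : Set Y} (hK : IsCompact K) :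
    ∃ M : ℝ, (∀ y ∈ K, ∀ z : ℂ, z ≠ z₀ → dist z z₀ ≤ ρ / 2 → ‖(z - z₀) * Ec z y‖ ≤ M) ∧ ∀ y ∈ K, ‖Fp y z₀‖ ≤ M := by
  have hS : IsCompact (sphere z₀ (ρ / 2)) := isCompact_sphere _ _
  have hSD : sphere z₀ (ρ / 2) ⊆ D := fun w hw => by
    have hw' : dist w z₀ = ρ / 2 := hw
    refine hρD w (fun h => ?_) (by rw [hw']; linarith)
    rw [h, dist_self] at hw'
    linarith
  obtain ⟨M₀, hM₀⟩ := exists_forall_norm_le_of_isCompact_of_locally_bounded Ec hS hSD fun z₁ hz₁ => hEbd z₁ hz₁ K hK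
  set M : ℝ := ρ / 2 * max M₀ 0 with hM
  have hsphere : ∀ y ∈ K, ∀ w ∈ sphere z₀ (ρ / 2), ‖(if w = z₀ then Fp y z₀ else (w - z₀) * Ec w y)‖ ≤ M := fun y hy w hw => by
    have hw' : dist w z₀ = ρ / 2 := hw
    have hw2 : w ≠ z₀ := fun h => by rw [h, dist_self] at hw'; linarith
    rw [if_neg hw2, norm_mul, ← dist_eq_norm, hw', hM]
    exact mul_le_mul_of_nonneg_left ((hM₀ w hw y hy).trans (le_max_left _ _)) (by linarith)
  have hball := norm_le_of_sphere_bound (half_pos hρ) (half_lt_self hρ) (fun y _ => differentiableOn_extension_at Ec hDo z₀ hρD hEd Fp hF hFE y) hsphere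
  refine ⟨M, fun y hy z hz2 hz => ?_, fun y hy => ?_⟩
  · have h := hball y hy z (mem_closedBall.2 hz)
    rwa [if_neg hz2] at h
  · have h := hball y hy z₀ (mem_closedBall_self (by linarith))
    rwa [if_pos rfl] at h

/-! ## §2 Holomorphy of the weighted orbit integral -/

/-- **`z ↦ ∫₀^{2π} w(θ)·Ẽ(z)(orb θ) dθ` IS HOLOMORPHIC ON `D`** under (E1)(E4)(E2-bd), for a continuous orbit and a continuous weight (★ `differentiableOn_integral_of_dominated` on
`dθ|_(0,2π]`; the bound near each `z₁ ∈ D` comes from (E2-bd) on the compact `orb([0, 2π])`). [cite: MoeglinWaldspurger1995, IV.1.9] -/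
theorem differentiableOn_orbitIntegral (Ec : ℂ → Y → ℂ) {D : Set ℂ} (hDo : IsOpen D)
    (hEd : ∀ y, DifferentiableOn ℂ (fun z => Ec z y) D) (hEc : ∀ z ∈ D, Continuous (Ec z))
    (hEbd : ∀ z₁ ∈ D, ∀ K : Set Y, IsCompact K → ∃ V ∈ 𝓝 z₁, ∃ M : ℝ, ∀ z ∈ V, ∀ y ∈ K, ‖Ec z y‖ ≤ M)
    {orb : ℝ → Y} (horb : Continuous orb) {w : ℝ → ℂ} (hw : Continuous w) :
    DifferentiableOn ℂ (fun z => ∫ θ in (0 : ℝ)..2 * π, w θ * Ec z (orb θ)) D := by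
  have h2π : (0 : ℝ) ≤ 2 * π := by positivity
  have hfun : (fun z => ∫ θ in (0 : ℝ)..2 * π, w θ * Ec z (orb θ)) = fun z => ∫ θ in Ioc (0 : ℝ) (2 * π), w θ * Ec z (orb θ) :=
    funext fun z => intervalIntegral.integral_of_le h2π
  rw [hfun]
  haveI : IsFiniteMeasure (volume.restrict (Ioc (0 : ℝ) (2 * π))) := by infer_instance
  -- a bound for the weight on `[0, 2π]`
  obtain ⟨Mw, hMw⟩ := (isCompact_Icc (a := (0 : ℝ)) (b := 2 * π)).exists_bound_of_continuousOn hw.continuousOn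
  refine Literature.Analysis.Complex.differentiableOn_integral_of_dominated (μ := volume.restrict (Ioc (0 : ℝ) (2 * π)))
    (F := fun z θ => w θ * Ec z (orb θ)) (U := D) (fun z hz => ?_) ?_ fun z₁ hz₁ => ?_
  · exact (hw.mul ((hEc z hz).comp horb)).aestronglyMeasurable
  · exact Filter.Eventually.of_forall fun θ => (differentiableOn_const (w θ)).mul (hEd (orb θ))
  · obtain ⟨V, hV, M, hM⟩ := hEbd z₁ hz₁ (orb '' Icc (0 : ℝ) (2 * π)) ((isCompact_Icc).image horb)
    obtain ⟨R₁, hR₁, hR₁V⟩ := Metric.mem_nhds_iff.1 hV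
    obtain ⟨R₂, hR₂, hR₂D⟩ := Metric.isOpen_iff.1 hDo z₁ hz₁
    refine ⟨min R₁ R₂, lt_min hR₁ hR₂, (ball_subset_ball (min_le_right _ _)).trans hR₂D, fun _ => Mw * max M 0, integrable_const _, ?_⟩
    refine (ae_restrict_iff' measurableSet_Ioc).2 (Filter.Eventually.of_forall fun θ hθ z hz => ?_)
    rw [norm_mul]
    exact mul_le_mul (hMw θ (Ioc_subset_Icc_self hθ)) ((hM z (hR₁V (ball_subset_ball (min_le_left _ _) hz)) _ ⟨θ, Ioc_subset_Icc_self hθ, rfl⟩).trans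
      (le_max_left _ _)) (norm_nonneg _) ((norm_nonneg _).trans (hMw 0 (left_mem_Icc.2 h2π)))

/-! ## §3 The identity on the whole domain -/

/-- **CONTINUATION OF THE ORBIT-INTEGRAL IDENTITY**: on an open preconnected `D` carrying (E1)(E4)(E2-bd), with `C` holomorphic on `D`, if
`∫₀^{2π} w(θ)·Ẽ(z)(orb θ) dθ = C(z)·Ẽ(z)(y₀)` for all `z` near one point `z₁ ∈ D`, then it holds for every `z ∈ D` (identity theorem; both sides holomorphic on `D` by §2).
[cite: Conway1978, IV §3] [cite: MoeglinWaldspurger1995, IV.1.9] -/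
theorem orbitIntegral_eq_of_eventuallyEq (Ec : ℂ → Y → ℂ) {D : Set ℂ} (hDo : IsOpen D) (hDc : IsPreconnected D)
    (hEd : ∀ y, DifferentiableOn ℂ (fun z => Ec z y) D) (hEc : ∀ z ∈ D, Continuous (Ec z))
    (hEbd : ∀ z₁ ∈ D, ∀ K : Set Y, IsCompact K → ∃ V ∈ 𝓝 z₁, ∃ M : ℝ, ∀ z ∈ V, ∀ y ∈ K, ‖Ec z y‖ ≤ M)
    {orb : ℝ → Y} (horb : Continuous orb) {w : ℝ → ℂ} (hw : Continuous w) (y₀ : Y) {C : ℂ → ℂ} (hC : DifferentiableOn ℂ C D)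
    {z₁ : ℂ} (hz₁ : z₁ ∈ D) (hgerm : ∀ᶠ z in 𝓝 z₁, (∫ θ in (0 : ℝ)..2 * π, w θ * Ec z (orb θ)) = C z * Ec z y₀)
    {z : ℂ} (hz : z ∈ D) :
    (∫ θ in (0 : ℝ)..2 * π, w θ * Ec z (orb θ)) = C z * Ec z y₀ := by
  have hL : AnalyticOnNhd ℂ (fun z => ∫ θ in (0 : ℝ)..2 * π, w θ * Ec z (orb θ)) D :=
    (Complex.analyticOnNhd_iff_differentiableOn hDo).2 (differentiableOn_orbitIntegral Ec hDo hEd hEc hEbd horb hw)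
  have hR : AnalyticOnNhd ℂ (fun z => C z * Ec z y₀) D := (Complex.analyticOnNhd_iff_differentiableOn hDo).2 (hC.mul (hEd y₀))
  exact hL.eqOn_of_preconnected_of_eventuallyEq hR hDc hz₁ hgerm hz

/-! ## §4 The residue inherits the identity -/

/-- **THE RESIDUE INHERITS THE ORBIT-INTEGRAL IDENTITY.**  Let `D` be open with (E1)(E2-bd)(E4), containing the punctured ball `B(z₀, ρ)∖{z₀}`; let the identity
`∫₀^{2π} w·Ẽ(z)∘orb = C(z)·Ẽ(z)(y₀)` hold on `D` (§3), `C` continuous at `z₀` within `≠`, and let `Fp y` (analytic at `z₀`) agree with `(z − z₀)Ẽ(z)(y)` on `𝓝[≠] z₀` for every `y`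
(simple-pole residue letter, ★ N = 3 (F)).  THEN the residue function `ψ(y) := Fp y z₀` satisfies **`∫₀^{2π} w(θ)·ψ(orb θ) dθ = C(z₀)·ψ(y₀)`** — dominated convergence along `𝓝[≠] z₀`
with the compact-uniform bound of §1 on `orb([0, 2π])`. [cite: MoeglinWaldspurger1995, IV.1.11] [cite: Langlands1976, §7] -/
theorem orbitIntegral_residue_eq (Ec : ℂ → Y → ℂ) {D : Set ℂ} (hDo : IsOpen D) (z₀ : ℂ) {ρ : ℝ} (hρ : 0 < ρ)
    (hρD : ∀ z : ℂ, z ≠ z₀ → dist z z₀ < ρ → z ∈ D) (hEd : ∀ y, DifferentiableOn ℂ (fun z => Ec z y) D) (hEc : ∀ z ∈ D, Continuous (Ec z))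
    (hEbd : ∀ z₁ ∈ D, ∀ K : Set Y, IsCompact K → ∃ V ∈ 𝓝 z₁, ∃ M : ℝ, ∀ z ∈ V, ∀ y ∈ K, ‖Ec z y‖ ≤ M)
    (Fp : Y → ℂ → ℂ) (hF : ∀ y, AnalyticAt ℂ (Fp y) z₀) (hFE : ∀ y, Fp y =ᶠ[𝓝[≠] z₀] fun z => (z - z₀) * Ec z y)
    {orb : ℝ → Y} (horb : Continuous orb) {w : ℝ → ℂ} (hw : Continuous w) (y₀ : Y) {C : ℂ → ℂ} (hC : ContinuousWithinAt C {z₀}ᶜ z₀)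
    (hid : ∀ z ∈ D, (∫ θ in (0 : ℝ)..2 * π, w θ * Ec z (orb θ)) = C z * Ec z y₀) :
    (∫ θ in (0 : ℝ)..2 * π, w θ * Fp (orb θ) z₀) = C z₀ * Fp y₀ z₀ := by
  have h2π : (0 : ℝ) ≤ 2 * π := by positivity
  -- the punctured half-ball lies in `D` and is a `𝓝[≠] z₀`-neighbourhood
  have hmem : {z : ℂ | z ≠ z₀} ∩ ball z₀ (ρ / 2) ∈ 𝓝[≠] z₀ := inter_mem_nhdsWithin _ (ball_mem_nhds _ (half_pos hρ))
  have hD' : ∀ z ∈ {z : ℂ | z ≠ z₀} ∩ ball z₀ (ρ / 2), z ∈ D := fun z hz => hρD z hz.1 ((mem_ball.1 hz.2).trans (half_lt_self hρ))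
  -- pointwise residue limits
  have hpt : ∀ y : Y, Tendsto (fun z => (z - z₀) * Ec z y) (𝓝[≠] z₀) (𝓝 (Fp y z₀)) := fun y =>
    ((hF y).continuousAt.tendsto.mono_left nhdsWithin_le_nhds).congr' (hFE y)
  -- the weight and the compact-uniform bound on the orbit
  obtain ⟨Mw, hMw⟩ := (isCompact_Icc (a := (0 : ℝ)) (b := 2 * π)).exists_bound_of_continuousOn hw.continuousOn
  obtain ⟨M, hM, -⟩ := exists_forall_norm_sub_mul_le_near Ec hDo z₀ hρ hρD hEd hEbd Fp hF hFE ((isCompact_Icc (a := (0 : ℝ)) (b := 2 * π)).image horb)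
  -- LHS: dominated convergence along `𝓝[≠] z₀`
  have hLHS : Tendsto (fun z => ∫ θ in (0 : ℝ)..2 * π, w θ * ((z - z₀) * Ec z (orb θ))) (𝓝[≠] z₀) (𝓝 (∫ θ in (0 : ℝ)..2 * π, w θ * Fp (orb θ) z₀)) := by
    refine intervalIntegral.tendsto_integral_filter_of_dominated_convergence (μ := volume) (fun _ => Mw * M) ?_ ?_ intervalIntegrable_const ?_
    · filter_upwards [hmem] with z hz
      exact (hw.mul (continuous_const.mul ((hEc z (hD' z hz)).comp horb))).aestronglyMeasurable
    · filter_upwards [hmem] with z hz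
      refine Filter.Eventually.of_forall fun θ hθ => ?_
      have hθ' : θ ∈ Icc (0 : ℝ) (2 * π) := by rw [uIoc_of_le h2π] at hθ; exact Ioc_subset_Icc_self hθ
      rw [norm_mul]
      exact mul_le_mul (hMw θ hθ') (hM (orb θ) ⟨θ, hθ', rfl⟩ z hz.1 (mem_ball.1 hz.2).le) (norm_nonneg _) ((norm_nonneg _).trans (hMw 0 (left_mem_Icc.2 h2π)))
    · exact Filter.Eventually.of_forall fun θ _ => (hpt (orb θ)).const_mul (w θ)
  -- RHS
  have hRHS : Tendsto (fun z => C z * ((z - z₀) * Ec z y₀)) (𝓝[≠] z₀) (𝓝 (C z₀ * Fp y₀ z₀)) := hC.tendsto.mul (hpt y₀)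
  -- the two functions agree on `𝓝[≠] z₀`
  have heq : (fun z => ∫ θ in (0 : ℝ)..2 * π, w θ * ((z - z₀) * Ec z (orb θ))) =ᶠ[𝓝[≠] z₀] fun z => C z * ((z - z₀) * Ec z y₀) := by
    filter_upwards [hmem] with z hz
    have h := hid z (hD' z hz)
    calc (∫ θ in (0 : ℝ)..2 * π, w θ * ((z - z₀) * Ec z (orb θ))) = (z - z₀) * ∫ θ in (0 : ℝ)..2 * π, w θ * Ec z (orb θ) := by
          rw [← intervalIntegral.integral_const_mul]
          exact intervalIntegral.integral_congr fun θ _ => by ring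
      _ = C z * ((z - z₀) * Ec z y₀) := by rw [h]; ring
  exact tendsto_nhds_unique (hLHS.congr' heq) hRHS

end Summit.HodgeConjecture.HodgeConjecture.Cruxes.H413.K2E1ContinuedCircleAverageResidue

end
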